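import Literature.Computability.MetaComplexity.AffineSystemClosure
import Literature.Computability.MetaComplexity.ResLinWidth
import Summits.PneNP.PneNP.Theorems.ReslinSizeFromWidthWidthFromVertexExpansionBridge
import Summits.PneNP.PneNP.Theorems.ReslinMediumCoverManyMediumLinesEdgeFlip

/-!
# PneNP / ReslinMediumCover — the BOUNDARY LAW for critical supports of Res(⊕) lines on
`τ(G, c) ∘ MAJ₃` (stub BL of the birth skeleton of crux `ManyMediumLines`, stmt-PneNP-19698)

Route `PneNP/ReslinMediumCover`, crux `Summit.PneNP.PneNP.Theses.ReslinMediumCover.ManyMediumLines`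
(open problem; NOT claimed here). This file proves the one quantitative input of the crux's
bottleneck-counting skeleton that is a theorem: the Res(⊕) form of the Ben-Sasson–Wigderson /
Urquhart "clauses of medium critical support are wide" step, ONE PROOF SYSTEM UP.

**Boundary law** (`ResLinBoundaryLaw.card_edgeCut_critSupport_succ_le_linClauseRank`). For every
graph `G` on `Fin N`, charge `c`, and every LINEAR clause `C`, with `S = critSupport G c C` (the
vertices `u` such that some `u`-critical assignment of `τ(G, c) ∘ MAJ₃` falsifies `C`):
if the edge boundary `∂S = edgeCut G S` is nonempty then `|∂S| + 1 ≤ rk(¬C) = linClauseRank C`.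
For connected `G` and `∅ ≠ S ≠ V` the boundary is nonempty
(`card_edgeCut_critSupport_succ_le_linClauseRank_of_connected`).

Proof. Write the falsifying assignments of `C` as the solution set of an affine system `Ψ` on the
`3 N²` variable slots (`rk Ψ ≤ linClauseRank C`), with one block of three slots per edge of `G`.
The CLOSURE LEMMA (`Literature.Computability.MetaComplexity.AffSys.exists_closure`,
Efremenko–Garlík–Itsykson 2024 §3–4 / Bhattacharya–Byramji–Chattopadhyay–Impagliazzo 2026 Lemma 4.5)
gives a set `Q₀` of edges, `Q₀ = ∅` or `|Q₀| + 1 ≤ rk Ψ`, outside of which, after freezing the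
slots of the `Q₀`-blocks and the free-standing slots, two of the three slots of every block are
jointly free; since `MAJ₃` is 1-stifling (two equal inputs force the output), every falsifier of
`C` can be modified inside the falsifiers of `C` so as to flip the lifted value of ONE prescribed
edge `{v, v'} ∉ Q₀` and keep all other lifted edge values. Flipping one edge at a `v`-critical
assignment gives a `v'`-critical one (`critAt_of_flip_edge`), so the critical support is closed
under adjacency along edges outside `Q₀` (`exists_closure_critSupport`), whence `∂S ⊆ Q₀`.
(The unlifted affine analogue is false: for plain Tseitin on `K₄` the two cut parities of `{1,2}`
and `{1,3}` confine the critical support to `{1}` with `|∂S| = 3 > 2` — lifting is essential.)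

Corollary (`exists_lt_linClauseRank_of_isResLinRefutation`): with the proved rung
`exists_medium_critSupport_of_isResLinRefutation` (every refutation has a line of medium critical
support, `N ≥ 24`), if every medium vertex set has more than `r` boundary edges then every Res(⊕)
refutation of `τ(G, c) ∘ MAJ₃` (dag-like, semantic weakening) has a line of rank `> r + 1` — a
direct rank lower bound for lifted Tseitin on expanders. In print a Res(⊕) WIDTH bound for every
1-stifling lift of a CNF requiring resolution width `w` is Alekseev–Itsykson (STOC 2025, via games;
quoted as Thm 1 in Efremenko–Itsykson CCC 2025); the present statement is a second, structural
proof for `MAJ₃`, not a new bound. No SIZE statement is made or implied (the medium-cover stub MC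
of the skeleton is the open part).

References: K. Efremenko, M. Garlík, D. Itsykson, STOC 2024, §3–§5 (closure; local consistency for
BPHP, Thm 5.5); S. K. Bhattacharya, F. Byramji, A. Chattopadhyay, R. Impagliazzo, STOC 2026, Thm 1.2,
§3.1, Lemma 4.5 (`τ(G,c) ∘ g` for 1-stifling `g`; stifling assignments outside the closure);
S. Jukna, *Boolean Function Complexity* (2012), §18.7, Thm 18.17 (resolution: a clause of critical
support `S` mentions every edge of `∂S`); A. Urquhart, J. ACM 34 (1987) §4; Y. Alekseev, D. Itsykson,
STOC 2025 (width lifting).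
-/

namespace Summit.PneNP.PneNP.Theorems

-- `Summit.PneNP.PneNP` repeats a path component by design (summit = sub-problem); silence the linter.
set_option linter.dupNamespace false

namespace ResLinBoundaryLaw

open Finset Module Literature.Computability.Complexity Literature.Computability.MetaComplexity
open Literature.Computability.MetaComplexity.AffSys

variable {N : ℕ}

variable (G : SimpleGraph (Fin N)) [DecidableRel G.Adj] (c : Fin N → Bool)

/-! ### The falsifiers of a linear clause as an affine system on the slots; the closure -/

/-- **The critical support is closed under adjacency along edges outside a closure.** For every linear
clause `C` there is a set `Q₀` of edges of `G` with `Q₀ = ∅` or `|Q₀| + 1 ≤ linClauseRank C` such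
that: if `v ∈ critSupport G c C`, `{v, v'}` is an edge of `G` not in `Q₀`, then
`v' ∈ critSupport G c C`. (Closure lemma on the affine system `¬C` over the `3N²` slots with one
three-slot block per edge, 1-stifling of `MAJ₃`, one edge flip.) -/
theorem exists_closure_critSupport (C : LinClause) :
    ∃ Q₀ : Finset (Sym2 (Fin N)), Q₀ ⊆ G.edgeFinset ∧ (Q₀ = ∅ ∨ Q₀.card + 1 ≤ linClauseRank C) ∧
      ∀ v ∈ critSupport G c C, ∀ v', G.Adj v v' → s(v, v') ∉ Q₀ → v' ∈ critSupport G c C := by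
  classical
  -- the slots, the blocks
  let E : Type := ↥G.edgeFinset
  let b : E → Fin 3 → Fin (3 * N ^ 2) := fun e i => ⟨liftVar e.1 i.1, liftVar_lt e.1 i.2⟩
  have hb : ∀ e e' i i', b e i = b e' i' → e = e' ∧ i = i' := by
    intro e e' i i' h
    have h' : liftVar e.1 i.1 = liftVar e'.1 i'.1 := congrArg Fin.val h
    obtain ⟨h1, h2⟩ := liftVar_inj i.2 i'.2 h'
    exact ⟨Subtype.ext h1, Fin.ext h2⟩
  -- the affine system `¬C` on the slots
  let formF : Finset ℕ → Fin (3 * N ^ 2) → ZMod 2 := fun f v => if (v : ℕ) ∈ f then 1 else 0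
  let rhs : Bool → ZMod 2 := fun bb => if bb = true then 0 else 1
  let enc : LinLit → (Fin (3 * N ^ 2) → ZMod 2) × ZMod 2 := fun l => (formF l.1, rhs l.2)
  let Ψ : AffSys (Fin (3 * N ^ 2)) := C.image enc
  let zvec : (Fin (3 * N ^ 2) → Bool) → Fin (3 * N ^ 2) → ZMod 2 :=
    fun x v => if x v = true then 1 else 0
  have hdec : ∀ bb : Bool, decide ((if bb = true then (1 : ZMod 2) else 0) = 1) = bb := by decide
  -- dictionary: `C` false at `pad x` iff `zvec x` solves `Ψ`
  have hdict : ∀ x : Fin (3 * N ^ 2) → Bool, C.eval (pad x) = false ↔ zvec x ∈ Sol Ψ := by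
    intro x
    rw [LinClause.eval_eq_false_iff, mem_Sol]
    constructor
    · intro h q hq
      have hq' : q ∈ C.image enc := hq
      obtain ⟨l, hl, rfl⟩ := Finset.mem_image.mp hq'
      have := (ResLinRank.linLit_eval_eq_false_iff (pad x) l.1 l.2).mp (h _ hl)
      rw [card_filter_pad_eq_dotProduct x l.1] at this
      exact this
    · intro h l hl
      have hmem : enc l ∈ C.image enc := Finset.mem_image.mpr ⟨l, hl, rfl⟩
      have hq := h (enc l) hmem
      rcases l with ⟨f, bb⟩
      apply (ResLinRank.linLit_eval_eq_false_iff (pad x) f bb).mpr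
      rw [card_filter_pad_eq_dotProduct x f]
      exact hq
  -- rank: `dim ⟨L(Ψ)⟩ ≤ linClauseRank C` (the forms of `Ψ` are restrictions of the forms of `C`)
  have hrank : finrank (ZMod 2) (spanS Ψ) ≤ linClauseRank C := by
    let restr : (ℕ → ZMod 2) →ₗ[ZMod 2] (Fin (3 * N ^ 2) → ZMod 2) :=
      LinearMap.funLeft (ZMod 2) (ZMod 2) (Fin.val : Fin (3 * N ^ 2) → ℕ)
    have hforms : (forms Ψ : Set (Fin (3 * N ^ 2) → ZMod 2)) = restr '' LinClause.forms C := by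
      ext w
      have hw : w ∈ (forms Ψ : Set (Fin (3 * N ^ 2) → ZMod 2)) ↔ ∃ l ∈ C, formF l.1 = w := by
        show w ∈ ((C.image enc).image Prod.fst : Set _) ↔ _
        rw [Finset.coe_image, Finset.coe_image, Set.mem_image]
        constructor
        · rintro ⟨q, ⟨l, hl, rfl⟩, rfl⟩
          exact ⟨l, hl, rfl⟩
        · rintro ⟨l, hl, rfl⟩
          exact ⟨enc l, ⟨l, hl, rfl⟩, rfl⟩
      rw [hw, Set.mem_image]
      simp only [LinClause.mem_forms_iff]
      constructor
      · rintro ⟨l, hl, rfl⟩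
        refine ⟨linFormVec l.1, ⟨l, hl, rfl⟩, ?_⟩
        funext v
        simp [restr, LinearMap.funLeft_apply, linFormVec_apply, formF]
      · rintro ⟨u, ⟨l, hl, rfl⟩, rfl⟩
        refine ⟨l, hl, ?_⟩
        funext v
        simp [restr, LinearMap.funLeft_apply, linFormVec_apply, formF]
    have hmap : spanS Ψ = (Submodule.span (ZMod 2) (LinClause.forms C)).map restr := by
      rw [spanS, hforms, Submodule.map_span]
    rw [linClauseRank_eq, hmap]
    haveI : Module.Finite (ZMod 2) (Submodule.span (ZMod 2) (LinClause.forms C)) :=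
      Module.Finite.span_of_finite (ZMod 2) (Set.finite_range _)
    exact Submodule.finrank_map_le restr _
  -- the closure
  obtain ⟨Q₀E, hsize, p, hprod⟩ :=
    AffSys.exists_closure (by norm_num : 0 < 3) b hb Ψ
  refine ⟨Q₀E.image Subtype.val, ?_, ?_, ?_⟩
  · intro e he
    obtain ⟨e', -, rfl⟩ := Finset.mem_image.mp he
    exact e'.2
  · rcases hsize with h | h
    · left
      rw [h, Finset.image_empty]
    · right
      rw [Finset.card_image_of_injective _ Subtype.val_injective]
      exact h.trans hrank
  -- closedness of the critical support under non-`Q₀` adjacency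
  intro v hv v' hadj hnot
  rw [mem_critSupport] at hv ⊢
  obtain ⟨x, hx, hfalse⟩ := hv
  have he₀ : s(v, v') ∈ G.edgeFinset := by
    rw [SimpleGraph.mem_edgeFinset]
    exact hadj
  let e₀ : E := ⟨s(v, v'), he₀⟩
  have he₀Q : e₀ ∉ Q₀E := fun h => hnot (Finset.mem_image.mpr ⟨e₀, h, rfl⟩)
  -- target lifted values: flip `e₀`, keep the rest
  let tv : E → Bool := fun e => if e = e₀ then !edgeVal (pad x) e.1 else edgeVal (pad x) e.1
  let t : E → Fin 3 → ZMod 2 := fun e _ => if tv e = true then 1 else 0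
  have hα : zvec x ∈ Sol Ψ := (hdict x).mp hfalse
  obtain ⟨β, hβ, hagree, hfree⟩ := hprod (zvec x) hα t
  -- back to Booleans
  let x' : Fin (3 * N ^ 2) → Bool := fun v => decide (β v = 1)
  have hzx' : zvec x' = β := by
    funext w
    have h2 : ∀ a : ZMod 2, (if decide (a = 1) = true then (1 : ZMod 2) else 0) = a := by decide
    exact h2 (β w)
  have hfalse' : C.eval (pad x') = false := (hdict x').mpr (by rw [hzx']; exact hβ)
  refine ⟨x', ?_, hfalse'⟩
  -- the lifted edge values of `x'`
  have hval : ∀ e : E, edgeVal (pad x') e.1 = tv e := by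
    intro e
    by_cases heQ : e ∈ Q₀E
    · -- a closure block: same slots as `x`
      have hslot : ∀ (i : ℕ) (hi : i < 3), pad x' (liftVar e.1 i) = pad x (liftVar e.1 i) := by
        intro i hi
        rw [pad_liftVar x' e.1 hi, pad_liftVar x e.1 hi]
        have h1 := hagree (b e ⟨i, hi⟩) (fun e' he' i' h => he' ((hb e' e i' ⟨i, hi⟩ h).1 ▸ heQ))
        show decide (β (b e ⟨i, hi⟩) = 1) = x (b e ⟨i, hi⟩)
        rw [h1]
        exact hdec (x (b e ⟨i, hi⟩))
      have hne : e ≠ e₀ := fun h => he₀Q (h ▸ heQ)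
      have : tv e = edgeVal (pad x) e.1 := by simp [tv, hne]
      rw [this]
      unfold edgeVal
      rw [hslot 0 (by norm_num), hslot 1 (by norm_num), hslot 2 (by norm_num)]
    · -- a free block: two slots carry the target bit
      have hslot : ∀ i : Fin 3, i ≠ p e → x' (b e i) = tv e := by
        intro i hi
        have h1 := hfree e heQ i hi
        show decide (β (b e i) = 1) = tv e
        rw [h1]
        exact hdec (tv e)
      unfold edgeVal
      rw [pad_liftVar x' e.1 (by norm_num : 0 < 3), pad_liftVar x' e.1 (by norm_num : 1 < 3),
        pad_liftVar x' e.1 (by norm_num : 2 < 3)]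
      exact gadgetMaj3_eq_of_two _ _ _ _ (p e) (fun h => hslot 0 (Ne.symm h))
        (fun h => hslot 1 (Ne.symm h)) (fun h => hslot 2 (Ne.symm h))
  -- one edge flip
  refine critAt_of_flip_edge G c hadj hx ?_ ?_
  · have := hval e₀
    simpa [tv] using this
  · intro e he hne
    have heF : e ∈ G.edgeFinset := SimpleGraph.mem_edgeFinset.mpr he
    have := hval ⟨e, heF⟩
    have hne' : (⟨e, heF⟩ : E) ≠ e₀ := fun h => hne (congrArg Subtype.val h)
    simpa [tv, hne'] using this

/-! ### The boundary law -/

/-- **Boundary law (rank form).** If the edge boundary of the critical support `S` of a linear clause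
`C` (with respect to `τ(G, c) ∘ MAJ₃`) is nonempty, then `|∂S| + 1 ≤ linClauseRank C`: a linear
clause whose critical support has `m ≥ 1` boundary edges has rank at least `m + 1`. (Resolution
version: a clause of critical support `S` mentions every edge of `∂S`, Jukna 2012 Thm 18.17.) -/
theorem card_edgeCut_critSupport_succ_le_linClauseRank (C : LinClause)
    (hne : (edgeCut G (critSupport G c C)).Nonempty) :
    (edgeCut G (critSupport G c C)).card + 1 ≤ linClauseRank C := by
  classical
  obtain ⟨Q₀, hQ₀E, hsize, hclosed⟩ := exists_closure_critSupport G c C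
  -- `∂S ⊆ Q₀`
  have hsub : edgeCut G (critSupport G c C) ⊆ Q₀ := by
    intro e he
    rw [mem_edgeCut] at he
    obtain ⟨heG, ⟨a, haS, hae⟩, ⟨b', hbS, hbe⟩⟩ := he
    by_contra hQ
    have hab : a ≠ b' := fun h => hbS (h ▸ haS)
    have heq : e = s(a, b') := by
      induction e using Sym2.ind with
      | h p q =>
        rw [Sym2.mem_iff] at hae hbe
        rcases hae with rfl | rfl <;> rcases hbe with rfl | rfl
        · exact absurd rfl hab
        · rfl
        · exact Sym2.eq_swap
        · exact absurd rfl hab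
    subst heq
    have hadj : G.Adj a b' := by rwa [SimpleGraph.mem_edgeSet] at heG
    exact hbS (hclosed a haS b' hadj hQ)
  rcases hsize with h | h
  · subst h
    obtain ⟨e, he⟩ := hne
    exact absurd (hsub he) (Finset.notMem_empty e)
  · exact (Nat.add_le_add_right (Finset.card_le_card hsub) 1).trans h

/-- **Boundary law for connected graphs.** If `G` is connected and the critical support `S` of the
linear clause `C` is neither empty nor everything, then `|edgeCut G S| + 1 ≤ linClauseRank C`. -/
theorem card_edgeCut_critSupport_succ_le_linClauseRank_of_connected (hG : G.Connected)
    (C : LinClause) (hS : (critSupport G c C).Nonempty) (hS' : critSupport G c C ≠ Finset.univ) :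
    (edgeCut G (critSupport G c C)).card + 1 ≤ linClauseRank C := by
  classical
  apply card_edgeCut_critSupport_succ_le_linClauseRank
  obtain ⟨a, ha⟩ := hS
  obtain ⟨b', hb'⟩ : ∃ b', b' ∉ critSupport G c C := by
    by_contra h
    push Not at h
    exact hS' (Finset.eq_univ_of_forall h)
  obtain ⟨p⟩ := hG a b'
  obtain ⟨d, -, hd1, hd2⟩ :=
    p.exists_boundary_dart (↑(critSupport G c C) : Set (Fin N)) (by simpa using ha) (by simpa using hb')
  refine ⟨d.edge, ?_⟩
  rw [mem_edgeCut]
  refine ⟨d.edge_mem, ⟨d.fst, by simpa using hd1, ?_⟩, ⟨d.snd, by simpa using hd2, ?_⟩⟩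
  · rw [SimpleGraph.Dart.edge]; exact Sym2.mem_mk_left _ _
  · rw [SimpleGraph.Dart.edge]; exact Sym2.mem_mk_right _ _

/-- **Direct rank lower bound for Res(⊕) on `τ(G, c) ∘ MAJ₃` over an edge expander.** If `N ≥ 24`,
every vertex has a critical assignment, and every MEDIUM vertex set `U` (`⌈N/8⌉ < |U| < N - ⌈N/8⌉`)
has more than `r` boundary edges, then every Res(⊕) refutation of `τ(G, c) ∘ MAJ₃` (dag-like,
semantic weakening) contains a line of rank `> r + 1`; in particular `r + 1 < resLinWidth π`.
(Medium line of the proved rung `exists_medium_critSupport_of_isResLinRefutation` + boundary law.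
A Res(⊕) width bound for 1-stifling lifts is Alekseev–Itsykson 2025, by games; this is a second
proof via critical supports.) -/
theorem exists_lt_linClauseRank_of_isResLinRefutation (hN : 24 ≤ N)
    (hcrit : ∀ u, (critAt G c u).Nonempty) (r : ℕ)
    (hexp : ∀ U : Finset (Fin N), (N + 7) / 8 < U.card → U.card + (N + 7) / 8 < N →
      r < (edgeCut G U).card)
    (π : List ResLinLine) (hπ : IsResLinRefutation (tseitinMaj G c) π) :
    ∃ l ∈ π, r + 1 < linClauseRank l.clause := by
  obtain ⟨l, hl, h1, h2⟩ := exists_medium_critSupport_of_isResLinRefutation N hN G c hcrit π hπ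
  refine ⟨l, hl, ?_⟩
  have hr := hexp _ h1 h2
  have hne : (edgeCut G (critSupport G c l.clause)).Nonempty := by
    rw [← Finset.card_pos]
    omega
  have := card_edgeCut_critSupport_succ_le_linClauseRank G c l.clause hne
  omega

/-- The same bound in terms of the width (maximal line rank) of the refutation. -/
theorem lt_resLinWidth_of_isResLinRefutation (hN : 24 ≤ N)
    (hcrit : ∀ u, (critAt G c u).Nonempty) (r : ℕ)
    (hexp : ∀ U : Finset (Fin N), (N + 7) / 8 < U.card → U.card + (N + 7) / 8 < N →
      r < (edgeCut G U).card)
    (π : List ResLinLine) (hπ : IsResLinRefutation (tseitinMaj G c) π) :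
    r + 1 < resLinWidth π := by
  obtain ⟨l, hl, h⟩ := exists_lt_linClauseRank_of_isResLinRefutation G c hN hcrit r hexp π hπ
  exact lt_resLinWidth_iff.mpr ⟨l, hl, h⟩

end ResLinBoundaryLaw

end Summit.PneNP.PneNP.Theorems
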